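import Summits.CriticalPhenomena.Ising3DConformalLimit.Theorems.LogPolarProxyExistsContinuousLimitDoublingSplit
import Summits.CriticalPhenomena.Ising3DConformalLimit.Theorems.ReflectionTwinExistsContinuousLimitFoldUnion
import Summits.CriticalPhenomena.Ising3DConformalLimit.Theorems.ReflectionTwinExistsContinuousLimitConfinement
import Summits.CriticalPhenomena.Ising3DConformalLimit.Theorems.ReflectionTwinExistsContinuousLimitSupermodular
import Summits.CriticalPhenomena.Ising3DConformalLimit.Theorems.ReflectionTwinExistsContinuousLimitFaceBound
import Summits.CriticalPhenomena.Ising3DConformalLimit.Theorems.ReflectionTwinExistsContinuousLimitMmsFaces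
import Summits.CriticalPhenomena.Ising3DConformalLimit.Theorems.ReflectionTwinExistsContinuousLimitTorusMaster
import HarnessLib

/-!
# The two FOLD CHAINS of the critical `ℤ³` Ising model, unconditionally; doubling and the crux from two free-box deficits

Crux `ExistsContinuousLimit` (item stmt-CriticalPhenomena-4582, routes `ReflectionTwin` / `LogPolarProxy`), line
`free-box-deficit` (lead c5, skeleton `Cruxes/ExistsContinuousLimit/Lines/free_box_deficit.lean`). This file composes the
six LANDED stubs of the line — GKS supermodularity of sourceless current sums (`stub_supermodular`, p162905), the
single-current confinement inequality (`stub_confinement`, p162852), the fold/union bound for a family of fold data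
(`stub_foldUnion`, p162769), the master inequality on the even torus (`stub_torusMaster`, p163069), its `ℤ³` limit at
`β_c` (`stub_faceBound`, p162939) and the Messager–Miracle-Solé bounds of the twelve reflected points
(`stub_mmsFaces`, p162881) — into the two **fold chains**, kernel-checked and UNCONDITIONAL:

* `axisFoldChain`: `g(n) − ⟨σ₀σ_{ne₀}⟩^free_{A_n} ≤ 6·G(n,n,0)` for `n ≥ 1`, `A_n = (−h, n+h) × (−h, h)²`, `h = ⌈n/2⌉`;
* `diagFoldChain`: `G(n,n,0) − ⟨σ₀σ_{(n,n,0)}⟩^free_{D_n} ≤ 6·g(2n)` for `n ≥ 1`, `D_n = (−h, n+h)² × (−n, n)`;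

(`g(n) = G(ne₀)`, `G = criticalTwoPoint 3`; the free boxes are the OPEN boxes, i.e. the lattice sites strictly inside),
and records the line's transfer: the two FREE-BOX DEFICITS (`⟨σ₀σ_{ne₀}⟩^free_{A_n} ≤ (1−c₁) g(n)`,
`⟨σ₀σ_{(n,n,0)}⟩^free_{D_n} ≤ (1−c₂) G(n,n,0)`, the open registered stub `stub_boxDeficits`) give item 6150
`TwoPointDoubling` with `κ = c₁c₂/36` (`twoPointDoubling_of_boxDeficits`) and, with item 4659 by name, the crux
(`existsContinuousLimit_of_boxDeficits`, via the landed split p149785).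

Mathematics (Aizenman 2025 Thm 14.2 / Duminil-Copin–Panis 2025 Lemma 2.3 for the folds; GKS; MMS): on the even torus
`(ℤ/Lℤ)³` all six face mirrors of a coordinate box are fold data at once; a sourced current whose cluster leaves the box
reaches a face plane inside the strict half, hence is a folded connection, and the fold identity turns each face into the
two-point function at the mirror image; the cluster staying inside the box is paid by the free-box two-point function
(confinement); `L → ∞` uses `m*(β_c) = 0` (torus → bulk); MMS bounds the twelve images.
-/

noncomputable section

namespace Summit.CriticalPhenomena.Ising3DConformalLimit.ReflectionTwinExistsContinuousLimit.FreeBox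

open Finset Filter
open scoped BigOperators symmDiff ENNReal Topology
open Literature.Probability.LatticeModels
open Summit.CriticalPhenomena.Ising3DConformalLimit.Theses
open Summit.CriticalPhenomena.Ising3DConformalLimit.LogPolarProxyExistsContinuousLimit
  (reflectionTwin_existsContinuousLimit_of_doubling_of_totallyDisconnected
    existsContinuousLimit_of_doubling_of_totallyDisconnected)
open Classical

/-- **The face bound on `ℤ³` at `β_c`, unconditionally**: for a coordinate box `[l,u]` and `x ≠ y` in it,
`G(y−x) − ⟨σₓσ_y⟩^free_{[l,u]} ≤ ∑_{faces F} G(𝓡_F y − x)` — `stub_faceBound` fed with `stub_torusMaster`, itself fed with the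
torus specialisations of `stub_confinement ∘ stub_supermodular` and `stub_foldUnion`. [folklore] -/
theorem faceBound (l u x y : Site 3) (hx : ∀ i, l i ≤ x i ∧ x i ≤ u i) (hy : ∀ i, l i ≤ y i ∧ y i ≤ u i) (hxy : x ≠ y) :
    criticalTwoPoint 3 (y - x) - isingTwoPoint (zdGraph 3) (Fintype.piFinset fun i => Finset.Icc (l i) (u i)) (criticalBeta 3) 0 .free x y ≤
      ∑ i : Fin 3, (criticalTwoPoint 3 (Function.update y i (2 * (u i + 1) - y i) - x) +
        criticalTwoPoint 3 (Function.update y i (2 * (l i - 1) - y i) - x)) := by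
  refine stub_faceBound (stub_torusMaster ?_ ?_) l u x y hx hy hxy
  · intro L _ β hβ T a b ha hb
    exact stub_confinement (torusGraph 3 L) univ hβ (stub_supermodular (torusGraph 3 L) univ hβ) T (subset_univ T) a b ha hb
  · intro L _ β hβ θ H hfold T hTH hexit a b ha hb
    exact stub_foldUnion (torusGraph 3 L) univ hβ θ H hfold T hTH hexit a b ha hb

/-- **AXIS FOLD CHAIN (unconditional).** For `n ≥ 1` and `h = ⌈n/2⌉ = (n+1)/2`:
`g(n) − ⟨σ₀σ_{ne₀}⟩^free_{A_n} ≤ 6·G(n,n,0)`, where `A_n` is the free box of lattice sites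
`{1−h ≤ z₀ ≤ n+h−1, |z₁| ≤ h−1, |z₂| ≤ h−1}`. [folklore] -/
theorem axisFoldChain' (n : ℕ) (hn : 1 ≤ n) :
    criticalTwoPoint 3 (Pi.single 0 (n : ℤ)) -
      isingTwoPoint (zdGraph 3)
          (Fintype.piFinset fun i : Fin 3 => Finset.Icc ((fun _ : Fin 3 => 1 - (((n + 1) / 2 : ℕ) : ℤ)) i)
            ((fun i : Fin 3 => if i = 0 then (n : ℤ) + (((n + 1) / 2 : ℕ) : ℤ) - 1 else (((n + 1) / 2 : ℕ) : ℤ) - 1) i))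
          (criticalBeta 3) 0 .free 0 (Pi.single 0 (n : ℤ)) ≤
      6 * criticalTwoPoint 3 (Pi.single 0 (n : ℤ) + Pi.single 1 (n : ℤ)) := by
  have hmem0 : ∀ i : Fin 3, (fun _ : Fin 3 => 1 - (((n + 1) / 2 : ℕ) : ℤ)) i ≤ (0 : Site 3) i ∧
      (0 : Site 3) i ≤ (fun i : Fin 3 => if i = 0 then (n : ℤ) + (((n + 1) / 2 : ℕ) : ℤ) - 1 else (((n + 1) / 2 : ℕ) : ℤ) - 1) i := by
    intro i; fin_cases i <;> simp <;> omega
  have hmem1 : ∀ i : Fin 3, (fun _ : Fin 3 => 1 - (((n + 1) / 2 : ℕ) : ℤ)) i ≤ (Pi.single 0 (n : ℤ) : Site 3) i ∧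
      (Pi.single 0 (n : ℤ) : Site 3) i ≤
        (fun i : Fin 3 => if i = 0 then (n : ℤ) + (((n + 1) / 2 : ℕ) : ℤ) - 1 else (((n + 1) / 2 : ℕ) : ℤ) - 1) i := by
    intro i; fin_cases i <;> simp <;> omega
  have hne : (0 : Site 3) ≠ Pi.single 0 (n : ℤ) := by
    intro h; have := congrFun h 0; simp at this; omega
  have hF := faceBound _ _ 0 (Pi.single 0 (n : ℤ)) hmem0 hmem1 hne
  simp only [sub_zero] at hF
  exact hF.trans (stub_mmsFaces n hn).1

/-- **DIAGONAL FOLD CHAIN (unconditional).** For `n ≥ 1` and `h = ⌈n/2⌉`: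
`G(n,n,0) − ⟨σ₀σ_{(n,n,0)}⟩^free_{D_n} ≤ 6·g(2n)`, where `D_n` is the free box of lattice sites
`{1−h ≤ z₀, z₁ ≤ n+h−1, |z₂| ≤ n−1}` (the anisotropic coordinate box: its six mirrors send `(n,n,0)` to sup-norm `≥ 2n`). [folklore] -/
theorem diagFoldChain' (n : ℕ) (hn : 1 ≤ n) :
    criticalTwoPoint 3 (Pi.single 0 (n : ℤ) + Pi.single 1 (n : ℤ)) -
      isingTwoPoint (zdGraph 3)
          (Fintype.piFinset fun i : Fin 3 => Finset.Icc ((fun i : Fin 3 => if i = 2 then 1 - (n : ℤ) else 1 - (((n + 1) / 2 : ℕ) : ℤ)) i)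
            ((fun i : Fin 3 => if i = 2 then (n : ℤ) - 1 else (n : ℤ) + (((n + 1) / 2 : ℕ) : ℤ) - 1) i))
          (criticalBeta 3) 0 .free 0 (Pi.single 0 (n : ℤ) + Pi.single 1 (n : ℤ)) ≤
      6 * criticalTwoPoint 3 (Pi.single 0 (2 * (n : ℤ))) := by
  have hmem0 : ∀ i : Fin 3, (fun i : Fin 3 => if i = 2 then 1 - (n : ℤ) else 1 - (((n + 1) / 2 : ℕ) : ℤ)) i ≤ (0 : Site 3) i ∧
      (0 : Site 3) i ≤ (fun i : Fin 3 => if i = 2 then (n : ℤ) - 1 else (n : ℤ) + (((n + 1) / 2 : ℕ) : ℤ) - 1) i := by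
    intro i; fin_cases i <;> simp <;> omega
  have hmem1 : ∀ i : Fin 3, (fun i : Fin 3 => if i = 2 then 1 - (n : ℤ) else 1 - (((n + 1) / 2 : ℕ) : ℤ)) i ≤
      (Pi.single 0 (n : ℤ) + Pi.single 1 (n : ℤ) : Site 3) i ∧
      (Pi.single 0 (n : ℤ) + Pi.single 1 (n : ℤ) : Site 3) i ≤
        (fun i : Fin 3 => if i = 2 then (n : ℤ) - 1 else (n : ℤ) + (((n + 1) / 2 : ℕ) : ℤ) - 1) i := by
    intro i; fin_cases i <;> simp <;> omega
  have hne : (0 : Site 3) ≠ Pi.single 0 (n : ℤ) + Pi.single 1 (n : ℤ) := by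
    intro h; have := congrFun h 0; simp at this; omega
  have hF := faceBound _ _ 0 (Pi.single 0 (n : ℤ) + Pi.single 1 (n : ℤ)) hmem0 hmem1 hne
  simp only [sub_zero] at hF
  exact hF.trans (stub_mmsFaces n hn).2

/-- **TRANSFER: the two free-box deficits give item 6150 `TwoPointDoubling` with `κ = c₁c₂/36`.**
(`c₁ g(n) ≤ g(n) − freeA(n) ≤ 6 Gd(n)` and `c₂ Gd(n) ≤ Gd(n) − freeD(n) ≤ 6 g(2n)`.) [folklore] -/
theorem twoPointDoubling_of_boxDeficits'
    (hA : ∃ c : ℝ, 0 < c ∧ ∀ n : ℕ, 1 ≤ n →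
      isingTwoPoint (zdGraph 3)
          (Fintype.piFinset fun i : Fin 3 => Finset.Icc ((fun _ : Fin 3 => 1 - (((n + 1) / 2 : ℕ) : ℤ)) i)
            ((fun i : Fin 3 => if i = 0 then (n : ℤ) + (((n + 1) / 2 : ℕ) : ℤ) - 1 else (((n + 1) / 2 : ℕ) : ℤ) - 1) i))
          (criticalBeta 3) 0 .free 0 (Pi.single 0 (n : ℤ)) ≤
        (1 - c) * criticalTwoPoint 3 (Pi.single 0 (n : ℤ)))
    (hD : ∃ c : ℝ, 0 < c ∧ ∀ n : ℕ, 1 ≤ n →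
      isingTwoPoint (zdGraph 3)
          (Fintype.piFinset fun i : Fin 3 => Finset.Icc ((fun i : Fin 3 => if i = 2 then 1 - (n : ℤ) else 1 - (((n + 1) / 2 : ℕ) : ℤ)) i)
            ((fun i : Fin 3 => if i = 2 then (n : ℤ) - 1 else (n : ℤ) + (((n + 1) / 2 : ℕ) : ℤ) - 1) i))
          (criticalBeta 3) 0 .free 0 (Pi.single 0 (n : ℤ) + Pi.single 1 (n : ℤ)) ≤
        (1 - c) * criticalTwoPoint 3 (Pi.single 0 (n : ℤ) + Pi.single 1 (n : ℤ))) :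
    MirrorHoelderCompactness.TwoPointDoubling := by
  obtain ⟨c₁, hc₁, h₁⟩ := hA
  obtain ⟨c₂, hc₂, h₂⟩ := hD
  refine ⟨c₁ * c₂ / 36, by positivity, fun n hn => ?_⟩
  have eA := axisFoldChain' n hn
  have eD := diagFoldChain' n hn
  have dA := h₁ n hn
  have dD := h₂ n hn
  have k₁ : c₁ * criticalTwoPoint 3 (Pi.single 0 (n : ℤ)) ≤ 6 * criticalTwoPoint 3 (Pi.single 0 (n : ℤ) + Pi.single 1 (n : ℤ)) := by
    linarith
  have k₂ : c₂ * criticalTwoPoint 3 (Pi.single 0 (n : ℤ) + Pi.single 1 (n : ℤ)) ≤ 6 * criticalTwoPoint 3 (Pi.single 0 (2 * (n : ℤ))) := by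
    linarith
  have k₃ : c₁ * c₂ * criticalTwoPoint 3 (Pi.single 0 (n : ℤ)) ≤ 6 * (c₂ * criticalTwoPoint 3 (Pi.single 0 (n : ℤ) + Pi.single 1 (n : ℤ))) := by
    nlinarith [k₁, hc₂.le]
  linarith

/-- **The crux from the two free-box deficits and item 4659 (by name)** — `ReflectionTwin` copy (the `LogPolarProxy` copy is
the same term). [folklore] -/
theorem existsContinuousLimit_of_boxDeficits
    (hA : ∃ c : ℝ, 0 < c ∧ ∀ n : ℕ, 1 ≤ n →
      isingTwoPoint (zdGraph 3)
          (Fintype.piFinset fun i : Fin 3 => Finset.Icc ((fun _ : Fin 3 => 1 - (((n + 1) / 2 : ℕ) : ℤ)) i)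
            ((fun i : Fin 3 => if i = 0 then (n : ℤ) + (((n + 1) / 2 : ℕ) : ℤ) - 1 else (((n + 1) / 2 : ℕ) : ℤ) - 1) i))
          (criticalBeta 3) 0 .free 0 (Pi.single 0 (n : ℤ)) ≤
        (1 - c) * criticalTwoPoint 3 (Pi.single 0 (n : ℤ)))
    (hD : ∃ c : ℝ, 0 < c ∧ ∀ n : ℕ, 1 ≤ n →
      isingTwoPoint (zdGraph 3)
          (Fintype.piFinset fun i : Fin 3 => Finset.Icc ((fun i : Fin 3 => if i = 2 then 1 - (n : ℤ) else 1 - (((n + 1) / 2 : ℕ) : ℤ)) i)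
            ((fun i : Fin 3 => if i = 2 then (n : ℤ) - 1 else (n : ℤ) + (((n + 1) / 2 : ℕ) : ℤ) - 1) i))
          (criticalBeta 3) 0 .free 0 (Pi.single 0 (n : ℤ) + Pi.single 1 (n : ℤ)) ≤
        (1 - c) * criticalTwoPoint 3 (Pi.single 0 (n : ℤ) + Pi.single 1 (n : ℤ)))
    (h4659 : ClusterRigidity.ClusterSetTotallyDisconnected) :
    ReflectionTwin.ExistsContinuousLimit :=
  reflectionTwin_existsContinuousLimit_of_doubling_of_totallyDisconnected (twoPointDoubling_of_boxDeficits' hA hD) h4659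

/-! ## Registered sub-goals (verbatim headers) -/

/-- **Registered sub-goal `axisFoldChain`** (verbatim signature): the axis fold chain. [folklore] -/
theorem axisFoldChain : ∀ n : ℕ, 1 ≤ n → Literature.Probability.LatticeModels.criticalTwoPoint 3 (Pi.single 0 (n : ℤ)) - Literature.Probability.LatticeModels.isingTwoPoint (Literature.Probability.LatticeModels.zdGraph 3) (Fintype.piFinset fun i : Fin 3 => Finset.Icc ((fun _ : Fin 3 => 1 - (((n + 1) / 2 : ℕ) : ℤ)) i) ((fun i : Fin 3 => if i = 0 then (n : ℤ) + (((n + 1) / 2 : ℕ) : ℤ) - 1 else (((n + 1) / 2 : ℕ) : ℤ) - 1) i)) (Literature.Probability.LatticeModels.criticalBeta 3) 0 .free 0 (Pi.single 0 (n : ℤ)) ≤ 6 * Literature.Probability.LatticeModels.criticalTwoPoint 3 (Pi.single 0 (n : ℤ) + Pi.single 1 (n : ℤ)) :=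
  fun n hn => axisFoldChain' n hn

/-- **Registered sub-goal `diagFoldChain`** (verbatim signature): the diagonal fold chain. [folklore] -/
theorem diagFoldChain : ∀ n : ℕ, 1 ≤ n → Literature.Probability.LatticeModels.criticalTwoPoint 3 (Pi.single 0 (n : ℤ) + Pi.single 1 (n : ℤ)) - Literature.Probability.LatticeModels.isingTwoPoint (Literature.Probability.LatticeModels.zdGraph 3) (Fintype.piFinset fun i : Fin 3 => Finset.Icc ((fun i : Fin 3 => if i = 2 then 1 - (n : ℤ) else 1 - (((n + 1) / 2 : ℕ) : ℤ)) i) ((fun i : Fin 3 => if i = 2 then (n : ℤ) - 1 else (n : ℤ) + (((n + 1) / 2 : ℕ) : ℤ) - 1) i)) (Literature.Probability.LatticeModels.criticalBeta 3) 0 .free 0 (Pi.single 0 (n : ℤ) + Pi.single 1 (n : ℤ)) ≤ 6 * Literature.Probability.LatticeModels.criticalTwoPoint 3 (Pi.single 0 (2 * (n : ℤ))) :=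
  fun n hn => diagFoldChain' n hn

/-- **Registered sub-goal `twoPointDoubling_of_boxDeficits`** (verbatim signature): the transfer to item 6150. [folklore] -/
theorem twoPointDoubling_of_boxDeficits : (∃ c : ℝ, 0 < c ∧ ∀ n : ℕ, 1 ≤ n → Literature.Probability.LatticeModels.isingTwoPoint (Literature.Probability.LatticeModels.zdGraph 3) (Fintype.piFinset fun i : Fin 3 => Finset.Icc ((fun _ : Fin 3 => 1 - (((n + 1) / 2 : ℕ) : ℤ)) i) ((fun i : Fin 3 => if i = 0 then (n : ℤ) + (((n + 1) / 2 : ℕ) : ℤ) - 1 else (((n + 1) / 2 : ℕ) : ℤ) - 1) i)) (Literature.Probability.LatticeModels.criticalBeta 3) 0 .free 0 (Pi.single 0 (n : ℤ)) ≤ (1 - c) * Literature.Probability.LatticeModels.criticalTwoPoint 3 (Pi.single 0 (n : ℤ))) → (∃ c : ℝ, 0 < c ∧ ∀ n : ℕ, 1 ≤ n → Literature.Probability.LatticeModels.isingTwoPoint (Literature.Probability.LatticeModels.zdGraph 3) (Fintype.piFinset fun i : Fin 3 => Finset.Icc ((fun i : Fin 3 => if i = 2 then 1 - (n : ℤ)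 else 1 - (((n + 1) / 2 : ℕ) : ℤ)) i) ((fun i : Fin 3 => if i = 2 then (n : ℤ) - 1 else (n : ℤ) + (((n + 1) / 2 : ℕ) : ℤ) - 1) i)) (Literature.Probability.LatticeModels.criticalBeta 3) 0 .free 0 (Pi.single 0 (n : ℤ) + Pi.single 1 (n : ℤ)) ≤ (1 - c) * Literature.Probability.LatticeModels.criticalTwoPoint 3 (Pi.single 0 (n : ℤ) + Pi.single 1 (n : ℤ))) → Summit.CriticalPhenomena.Ising3DConformalLimit.Theses.MirrorHoelderCompactness.TwoPointDoubling :=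
  fun hA hD => twoPointDoubling_of_boxDeficits' hA hD

end Summit.CriticalPhenomena.Ising3DConformalLimit.ReflectionTwinExistsContinuousLimit.FreeBox

end
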